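import Literature.MathematicalPhysics.QuantumFieldTheory.Balaban1983to89.B4Eq19LatticeOperators
import HarnessLib

/-!
# `UnitScaleGibbsCollarCoboundary` — THE `ℓ¹`-COBOUNDARY OF THE CUTOFF COMMUTATORS `E₁`, `C₂` OF A TRUNCATED POTENTIAL, POINTWISE:
# `|δ₂E₁| ≲ |∇χ|·|∇a| + |∇²χ|·|a|`, `|δ₂C₂| ≲ |∇χ|·|∇γ| + |∇²χ|·|γ|` (generic `ℤ^d`; the collar row of the re-line of LINE 28 «GrossTransfer»,
# crux `UnitScaleTilt.HistoryTailL` stmt-QuantumFields-19936 ∕ `MeanDeviationL` stmt-QuantumFields-23083)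

Cell `ym3-torus` (YM ladder rung R3 = continuum SU(2) Yang–Mills on T³ — a RUNG, NOT the Clay problem: not d = 4, not infinite volume, not a mass gap),
width seat `ym-ust-19936-w2` (gen 15), pen of record of `stub_linTest`.  WHY (bus 2026-08-29, accounting v2 (A)): ✓(Z-e) `CovariantDischargeTruncatedPotentialPairing.
curl_truncated_eq` writes the curl of the truncated potential as `d(χa) = ω − δ₃(χγ) − C₂ + E₁` with the commutators
`E₁(x,μ,ν) = (χ(x+e_μ) − χ x)·a(x+e_μ,ν) − (χ(x+e_ν) − χ x)·a(x+e_ν,μ)` and `C₂(x,μ,ν) = Σ_κ (χ x − χ(x−e_κ))·γ(x−e_κ,κ,μ,ν)`; ✓`UnitScaleGibbsCollarPairingSecondMoment`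
prices the pairing of `σ = E₁ − C₂` with the dressed curvature by `Σ_b |(δ₂σ)_b|`, `(δ₂σ)(x,ν) = Σ_μ (σ(x−e_μ,μ,ν) − σ(x,μ,ν))`.  THIS FILE is the pointwise
calculus of that coboundary: §1 the two four-term PRODUCT-RULE IDENTITIES (pure algebra, `ring`); §2 the pointwise bounds under `|∇χ| ≤ ρ` (both directions)
and `|∇∇χ| ≤ ρ₂` (pure and mixed second differences — the rows of ✓`UnitScaleGibbsSmoothLatticeCutoff.exists_smooth_cutoff`, `ρ = 2∕R`, `ρ₂ = 4∕R²`):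
★`abs_deltaTwo_E1_le`, ★`abs_deltaTwo_C2_le`; §3 the summed forms over a finset.  The sizes of `a, ∇a, γ, ∇γ` on the shell (monopole far-field rows of
the free Green kernel) are the consumer's.  Every operator is a FREE symbol pinned by a pointwise hypothesis (no `def`).
HONEST FRAMING.  Finite-difference algebra; `--supports` helper; proves no stub, crux, rung or summit statement; `stub_linTest`, «ShallowFluxSecondMomentL», (Q),
K1, `MeanDeviationL`, `HistoryTailL` are NOT proved; the Yang–Mills mass gap is NOT proved.
References: Giaquinta (1983) Ch. III §2 (cutoff commutators) [Giaquinta1984]; [Balaban1984PropagatorsII] (1.9) p. 226 (the `ℤ^d` letters).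
-/

noncomputable section

set_option autoImplicit false

open scoped BigOperators
open Finset

namespace Summit.QuantumFields.YangMills.Theorems.UnitScaleGibbsCollarCoboundary

open Literature.MathematicalPhysics.QuantumFieldTheory.Balaban1983to89.B4Eq19LatticeOperators

variable {d : ℕ}

/-! ## §1 The product-rule identities -/

/-- The `μ`-difference of the first commutator: `E₁(x−e_μ,μ,ν) − E₁(x,μ,ν) = −∇⁻_μχ(x)·∇_μa_ν(x) − Δ_μχ(x)·a(x+e_μ,ν) + ∇_νχ(x)·(a(x+e_ν,μ) − a(x−e_μ+e_ν,μ))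
+ (∇_νχ(x) − ∇_νχ(x−e_μ))·a(x−e_μ+e_ν,μ)`. [folklore] -/
theorem E1_bdiff_eq (χ : Zd d → ℝ) (a : Zd d → Fin d → ℝ) (E1 : Zd d → Fin d → Fin d → ℝ)
    (hE1 : ∀ x μ ν, E1 x μ ν = (χ (x + unitVec μ) - χ x) * a (x + unitVec μ) ν - (χ (x + unitVec ν) - χ x) * a (x + unitVec ν) μ)
    (x : Zd d) (μ ν : Fin d) :
    E1 (x - unitVec μ) μ ν - E1 x μ ν =
      -((χ x - χ (x - unitVec μ)) * (a (x + unitVec μ) ν - a x ν))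
        - ((χ (x + unitVec μ) - χ x) - (χ x - χ (x - unitVec μ))) * a (x + unitVec μ) ν
        + (χ (x + unitVec ν) - χ x) * (a (x + unitVec ν) μ - a (x - unitVec μ + unitVec ν) μ)
        + ((χ (x + unitVec ν) - χ x) - (χ (x - unitVec μ + unitVec ν) - χ (x - unitVec μ))) * a (x - unitVec μ + unitVec ν) μ := by
  rw [hE1, hE1, sub_add_cancel]
  ring

/-- The `μ`-difference of the second commutator: `C₂(x−e_μ,μ,ν) − C₂(x,μ,ν) = Σ_κ [∇⁻_κχ(x−e_μ)·(γ(x−e_μ−e_κ) − γ(x−e_κ)) + (∇⁻_κχ(x−e_μ) − ∇⁻_κχ(x))·γ(x−e_κ)]`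
(components `κ,μ,ν`). [folklore] -/
theorem C2_bdiff_eq (χ : Zd d → ℝ) (γ : Zd d → Fin d → Fin d → Fin d → ℝ) (C2 : Zd d → Fin d → Fin d → ℝ)
    (hC2 : ∀ x μ ν, C2 x μ ν = ∑ κ, (χ x - χ (x - unitVec κ)) * γ (x - unitVec κ) κ μ ν)
    (x : Zd d) (μ ν : Fin d) :
    C2 (x - unitVec μ) μ ν - C2 x μ ν =
      ∑ κ, ((χ (x - unitVec μ) - χ (x - unitVec μ - unitVec κ)) * (γ (x - unitVec μ - unitVec κ) κ μ ν - γ (x - unitVec κ) κ μ ν)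
        + ((χ (x - unitVec μ) - χ (x - unitVec μ - unitVec κ)) - (χ x - χ (x - unitVec κ))) * γ (x - unitVec κ) κ μ ν) := by
  rw [hC2, hC2, ← Finset.sum_sub_distrib]
  refine Finset.sum_congr rfl fun κ _ => ?_
  ring

/-! ## §2 Pointwise bounds -/

/-- ★ `|δ₂E₁(x,ν)| ≤ Σ_μ [ρ·(|a(x+e_μ,ν) − a(x,ν)| + |a(x+e_ν,μ) − a(x−e_μ+e_ν,μ)|) + ρ₂·(|a(x+e_μ,ν)| + |a(x−e_μ+e_ν,μ)|)]` under the Lipschitz rows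
`|χ(x+e_κ) − χ x| ≤ ρ` and the second-difference rows `|χ(x+e_κ) − 2χ x + χ(x−e_κ)| ≤ ρ₂`, `|(χ(x+e_ν) − χ x) − (χ(x−e_μ+e_ν) − χ(x−e_μ))| ≤ ρ₂`. [folklore] -/
theorem abs_deltaTwo_E1_le (χ : Zd d → ℝ) (a : Zd d → Fin d → ℝ) (E1 : Zd d → Fin d → Fin d → ℝ)
    (hE1 : ∀ x μ ν, E1 x μ ν = (χ (x + unitVec μ) - χ x) * a (x + unitVec μ) ν - (χ (x + unitVec ν) - χ x) * a (x + unitVec ν) μ)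
    {ρ ρ₂ : ℝ} (hρ : ∀ x (κ : Fin d), |χ (x + unitVec κ) - χ x| ≤ ρ)
    (hρ₂ : ∀ x (κ : Fin d), |(χ (x + unitVec κ) - χ x) - (χ x - χ (x - unitVec κ))| ≤ ρ₂)
    (hρ₂' : ∀ x (κ ι : Fin d), |(χ (x + unitVec ι) - χ x) - (χ (x - unitVec κ + unitVec ι) - χ (x - unitVec κ))| ≤ ρ₂)
    (x : Zd d) (ν : Fin d) :
    |∑ μ, (E1 (x - unitVec μ) μ ν - E1 x μ ν)| ≤
      ∑ μ : Fin d, (ρ * (|a (x + unitVec μ) ν - a x ν| + |a (x + unitVec ν) μ - a (x - unitVec μ + unitVec ν) μ|)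
        + ρ₂ * (|a (x + unitVec μ) ν| + |a (x - unitVec μ + unitVec ν) μ|)) := by
  refine (Finset.abs_sum_le_sum_abs _ _).trans (Finset.sum_le_sum fun μ _ => ?_)
  rw [E1_bdiff_eq χ a E1 hE1 x μ ν]
  have hρ0 : 0 ≤ ρ := (abs_nonneg _).trans (hρ x ν)
  have h1 : |χ x - χ (x - unitVec μ)| ≤ ρ := by
    have := hρ (x - unitVec μ) μ; rwa [sub_add_cancel] at this
  have h2 := hρ₂ x μ
  have h3 := hρ x ν
  have h4 := hρ₂' x μ ν
  have t1 : |-((χ x - χ (x - unitVec μ)) * (a (x + unitVec μ) ν - a x ν))| ≤ ρ * |a (x + unitVec μ) ν - a x ν| := by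
    rw [abs_neg, abs_mul]; exact mul_le_mul_of_nonneg_right h1 (abs_nonneg _)
  have t2 : |((χ (x + unitVec μ) - χ x) - (χ x - χ (x - unitVec μ))) * a (x + unitVec μ) ν| ≤ ρ₂ * |a (x + unitVec μ) ν| := by
    rw [abs_mul]; exact mul_le_mul_of_nonneg_right h2 (abs_nonneg _)
  have t3 : |(χ (x + unitVec ν) - χ x) * (a (x + unitVec ν) μ - a (x - unitVec μ + unitVec ν) μ)| ≤
      ρ * |a (x + unitVec ν) μ - a (x - unitVec μ + unitVec ν) μ| := by
    rw [abs_mul]; exact mul_le_mul_of_nonneg_right h3 (abs_nonneg _)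
  have t4 : |((χ (x + unitVec ν) - χ x) - (χ (x - unitVec μ + unitVec ν) - χ (x - unitVec μ))) * a (x - unitVec μ + unitVec ν) μ| ≤
      ρ₂ * |a (x - unitVec μ + unitVec ν) μ| := by
    rw [abs_mul]; exact mul_le_mul_of_nonneg_right h4 (abs_nonneg _)
  calc _ ≤ |-((χ x - χ (x - unitVec μ)) * (a (x + unitVec μ) ν - a x ν))| +
        |((χ (x + unitVec μ) - χ x) - (χ x - χ (x - unitVec μ))) * a (x + unitVec μ) ν| +
        |(χ (x + unitVec ν) - χ x) * (a (x + unitVec ν) μ - a (x - unitVec μ + unitVec ν) μ)| +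
        |((χ (x + unitVec ν) - χ x) - (χ (x - unitVec μ + unitVec ν) - χ (x - unitVec μ))) * a (x - unitVec μ + unitVec ν) μ| := by
          refine (abs_add_le _ _).trans (add_le_add ((abs_add_le _ _).trans (add_le_add ((abs_sub _ _).trans le_rfl) le_rfl)) le_rfl)
    _ ≤ _ := by linarith

/-- ★ `|δ₂C₂(x,ν)| ≤ Σ_μ Σ_κ [ρ·|γ(x−e_μ−e_κ,κ,μ,ν) − γ(x−e_κ,κ,μ,ν)| + ρ₂·|γ(x−e_κ,κ,μ,ν)|]` under the backward Lipschitz row `|χ x − χ(x−e_κ)| ≤ ρ` and the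
mixed second-difference row `|(χ(x−e_μ) − χ(x−e_μ−e_κ)) − (χ x − χ(x−e_κ))| ≤ ρ₂`. [folklore] -/
theorem abs_deltaTwo_C2_le (χ : Zd d → ℝ) (γ : Zd d → Fin d → Fin d → Fin d → ℝ) (C2 : Zd d → Fin d → Fin d → ℝ)
    (hC2 : ∀ x μ ν, C2 x μ ν = ∑ κ, (χ x - χ (x - unitVec κ)) * γ (x - unitVec κ) κ μ ν)
    {ρ ρ₂ : ℝ} (hρb : ∀ x (κ : Fin d), |χ x - χ (x - unitVec κ)| ≤ ρ)
    (hρ₂b : ∀ x (μ κ : Fin d), |(χ (x - unitVec μ) - χ (x - unitVec μ - unitVec κ)) - (χ x - χ (x - unitVec κ))| ≤ ρ₂)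
    (x : Zd d) (ν : Fin d) :
    |∑ μ, (C2 (x - unitVec μ) μ ν - C2 x μ ν)| ≤
      ∑ μ : Fin d, ∑ κ : Fin d, (ρ * |γ (x - unitVec μ - unitVec κ) κ μ ν - γ (x - unitVec κ) κ μ ν| + ρ₂ * |γ (x - unitVec κ) κ μ ν|) := by
  refine (Finset.abs_sum_le_sum_abs _ _).trans (Finset.sum_le_sum fun μ _ => ?_)
  rw [C2_bdiff_eq χ γ C2 hC2 x μ ν]
  refine (Finset.abs_sum_le_sum_abs _ _).trans (Finset.sum_le_sum fun κ _ => ?_)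
  have h1 := hρb (x - unitVec μ) κ
  have h2 := hρ₂b x μ κ
  have t1 : |(χ (x - unitVec μ) - χ (x - unitVec μ - unitVec κ)) * (γ (x - unitVec μ - unitVec κ) κ μ ν - γ (x - unitVec κ) κ μ ν)| ≤
      ρ * |γ (x - unitVec μ - unitVec κ) κ μ ν - γ (x - unitVec κ) κ μ ν| := by
    rw [abs_mul]; exact mul_le_mul_of_nonneg_right h1 (abs_nonneg _)
  have t2 : |((χ (x - unitVec μ) - χ (x - unitVec μ - unitVec κ)) - (χ x - χ (x - unitVec κ))) * γ (x - unitVec κ) κ μ ν| ≤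
      ρ₂ * |γ (x - unitVec κ) κ μ ν| := by
    rw [abs_mul]; exact mul_le_mul_of_nonneg_right h2 (abs_nonneg _)
  exact (abs_add_le _ _).trans (add_le_add t1 t2)

/-! ## §3 Summed over a finite set of bonds -/

/-- The summed `E₁` row: `Σ_{x∈B} Σ_ν |δ₂E₁(x,ν)| ≤ ρ·Σ_{x∈B}Σ_νΣ_μ(|∇_μa_ν(x)| + |a(x+e_ν,μ) − a(x−e_μ+e_ν,μ)|) + ρ₂·Σ_{x∈B}Σ_νΣ_μ(|a(x+e_μ,ν)| + |a(x−e_μ+e_ν,μ)|)`. [folklore] -/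
theorem sum_abs_deltaTwo_E1_le (χ : Zd d → ℝ) (a : Zd d → Fin d → ℝ) (E1 : Zd d → Fin d → Fin d → ℝ)
    (hE1 : ∀ x μ ν, E1 x μ ν = (χ (x + unitVec μ) - χ x) * a (x + unitVec μ) ν - (χ (x + unitVec ν) - χ x) * a (x + unitVec ν) μ)
    {ρ ρ₂ : ℝ} (hρ : ∀ x (κ : Fin d), |χ (x + unitVec κ) - χ x| ≤ ρ)
    (hρ₂ : ∀ x (κ : Fin d), |(χ (x + unitVec κ) - χ x) - (χ x - χ (x - unitVec κ))| ≤ ρ₂)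
    (hρ₂' : ∀ x (κ ι : Fin d), |(χ (x + unitVec ι) - χ x) - (χ (x - unitVec κ + unitVec ι) - χ (x - unitVec κ))| ≤ ρ₂)
    (B : Finset (Zd d)) :
    ∑ x ∈ B, ∑ ν, |∑ μ, (E1 (x - unitVec μ) μ ν - E1 x μ ν)| ≤
      ρ * ∑ x ∈ B, ∑ ν : Fin d, ∑ μ : Fin d, (|a (x + unitVec μ) ν - a x ν| + |a (x + unitVec ν) μ - a (x - unitVec μ + unitVec ν) μ|)
        + ρ₂ * ∑ x ∈ B, ∑ ν : Fin d, ∑ μ : Fin d, (|a (x + unitVec μ) ν| + |a (x - unitVec μ + unitVec ν) μ|) := by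
  rw [Finset.mul_sum, Finset.mul_sum, ← Finset.sum_add_distrib]
  refine Finset.sum_le_sum fun x _ => ?_
  rw [Finset.mul_sum, Finset.mul_sum, ← Finset.sum_add_distrib]
  refine Finset.sum_le_sum fun ν _ => ?_
  rw [Finset.mul_sum, Finset.mul_sum, ← Finset.sum_add_distrib]
  exact abs_deltaTwo_E1_le χ a E1 hE1 hρ hρ₂ hρ₂' x ν

/-- The summed `C₂` row: `Σ_{x∈B} Σ_ν |δ₂C₂(x,ν)| ≤ ρ·Σ_{x∈B}Σ_νΣ_μΣ_κ|γ(x−e_μ−e_κ,κ,μ,ν) − γ(x−e_κ,κ,μ,ν)| + ρ₂·Σ_{x∈B}Σ_νΣ_μΣ_κ|γ(x−e_κ,κ,μ,ν)|`. [folklore] -/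
theorem sum_abs_deltaTwo_C2_le (χ : Zd d → ℝ) (γ : Zd d → Fin d → Fin d → Fin d → ℝ) (C2 : Zd d → Fin d → Fin d → ℝ)
    (hC2 : ∀ x μ ν, C2 x μ ν = ∑ κ, (χ x - χ (x - unitVec κ)) * γ (x - unitVec κ) κ μ ν)
    {ρ ρ₂ : ℝ} (hρb : ∀ x (κ : Fin d), |χ x - χ (x - unitVec κ)| ≤ ρ)
    (hρ₂b : ∀ x (μ κ : Fin d), |(χ (x - unitVec μ) - χ (x - unitVec μ - unitVec κ)) - (χ x - χ (x - unitVec κ))| ≤ ρ₂)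
    (B : Finset (Zd d)) :
    ∑ x ∈ B, ∑ ν, |∑ μ, (C2 (x - unitVec μ) μ ν - C2 x μ ν)| ≤
      ρ * ∑ x ∈ B, ∑ ν : Fin d, ∑ μ : Fin d, ∑ κ : Fin d, |γ (x - unitVec μ - unitVec κ) κ μ ν - γ (x - unitVec κ) κ μ ν|
        + ρ₂ * ∑ x ∈ B, ∑ ν : Fin d, ∑ μ : Fin d, ∑ κ : Fin d, |γ (x - unitVec κ) κ μ ν| := by
  rw [Finset.mul_sum, Finset.mul_sum, ← Finset.sum_add_distrib]
  refine Finset.sum_le_sum fun x _ => ?_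
  rw [Finset.mul_sum, Finset.mul_sum, ← Finset.sum_add_distrib]
  refine Finset.sum_le_sum fun ν _ => ?_
  refine (abs_deltaTwo_C2_le χ γ C2 hC2 hρb hρ₂b x ν).trans (le_of_eq ?_)
  rw [Finset.mul_sum, Finset.mul_sum, ← Finset.sum_add_distrib]
  refine Finset.sum_congr rfl fun μ _ => ?_
  rw [Finset.mul_sum, Finset.mul_sum, ← Finset.sum_add_distrib]

end Summit.QuantumFields.YangMills.Theorems.UnitScaleGibbsCollarCoboundary

end
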